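/-
Copyright (c) 2026. All rights reserved.
Released under Apache 2.0 license as described in the file LICENSE.
Authors: abc-iut cell, prover seat abc-iut-L5-t12 (gen 14).
-/
import Literature.IUT.LogVolume.DifferentEstimatesCorollaries
import Literature.IUT.LogVolume.RelativeIntegerRing
import Literature.IUT.LogVolume.Teichmuller
import Mathlib.Analysis.Normed.Algebra.Basic
import Mathlib.Analysis.Normed.Module.FiniteDimension
import Mathlib.NumberTheory.Padics.ProperSpace
import Mathlib.FieldTheory.IntermediateField.Adjoin.Basic
import Mathlib.RingTheory.DedekindDomain.Different
import HarnessLib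

/-!
# The maximal unramified subfield `K₀ = ℚ_p(μ_{q−1}) ⊆ K` and the SHARP (Hensel–Ore) bound
# `d ≤ 1 − 1/e + v_p(e)` for the different of a `p`-adic field

Classical local number theory (J.-P. Serre, *Corps locaux*, Ch. I §4, Ch. III §5 Thm. 3 / §6 Prop. 13 and
the Remark following it; J. Neukirch, *ANT*, Ch. II (5.3), (7.12), Ch. III (2.6)); nothing disputed.  PROOF-ONLY
file (no definition, no instance, no named `Prop` fact) of the abc-iut cell in the norm-side MLF setting of
`RamificationInvariants.lean` / `IntegerRing.lean` (`e = absRamificationIdx p K`, `f = residueDegree p K`,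
`d = differentOrd p K`, `𝔇(𝒪_K/ℤ_p) = 𝔪^δ`, `d = δ/e`), for a field `K` with
`[NontriviallyNormedField K] [NormedAlgebra ℚ_[p] K] [IsUltrametricDist K] [ProperSpace K]`:

* `exists_isPrimitiveRoot_residueCard_sub_one` — `K` contains a primitive `(q − 1)`-th root of unity,
  `q = p^f` (abc-iut-S1's `card_rootsOfUnity_residueCard_sub_one` + cyclicity);
* `le_residueCard_sub_one_of_isPrimitiveRoot` — a primitive `n`-th root of unity with `p ∤ n` forces
  `n ≤ q − 1` (roots of unity of order prime to `p` are separated modulo `𝔪`, abc-iut-S1's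
  `eq_one_of_pow_eq_one_of_not_dvd`);
* `different_eq_top_of_adjoin_eq_top_of_pow_eq_one`, `absRamificationIdx_eq_one_of_different_eq_top` —
  **`K = ℚ_p(ζ)` with `ζⁿ = 1`, `p ∤ n` ⇒ `𝔇 = (1)`, `d = 0`, `e = 1`** (Mathlib's
  `aeval_derivative_mem_differentIdeal`: `g′(ζ) ∈ 𝔇` for `g = minpoly`, and `g ∣ Xⁿ − 1` makes `g′(ζ)` divide
  the unit `n·ζ^{n−1}`);
* **`exists_maximalUnramified_intermediateField`** — there is an intermediate field `ℚ_p ⊆ K₀ ⊆ K`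
  (namely `K₀ = ℚ_p(ζ_{q−1})`) with `e(K₀) = 1`, `d(K₀) = 0`, `f(K₀) = f(K)`, `[K : K₀] = e(K)` and
  `[K₀ : ℚ_p] = f(K)` — the maximal unramified subextension;
* **`differentOrd_lt_one_add_padicValNat_absRamificationIdx`** — `d < 1 + v_p(e)`, i.e. Lenstra's bound
  (abc-iut-L5-t15's `differentOrd_lt`) over the base `K₀` (`d₀ = 0`, `e₀ = 1`, `[K : K₀] = e`), instead of
  over `ℚ_p` where it only gives `d < 1 + v_p([K : ℚ_p])` (`differentOrd_lt_one_add_padicValNat_finrank`);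
* **`differentOrd_le_one_sub_inv_add_padicValNat`** — the SHARP Hensel–Ore bound
  **`d ≤ 1 − 1/e + v_p(e)`**, equivalently (`natCast_mul_differentOrd_le`, `different_exponent_le`)
  **`δ ≤ e − 1 + e·v_p(e)`** for `𝔇 = 𝔪^δ` (Serre III §6 Remark: `v_K(𝔇) ≤ e − 1 + v_K(e)`).

PURPOSE (R-W lane of the cell, GAP-LEDGER G-Wnum2-1 (ii) REFUTED side / abc-iut-w5-d157's route (R1)
«LENSTRA-SHARP»): the upper bound on the wild different `δ ≤ e − 1 + e·v_p(e)` of the genuine completions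
`K_{x₀}` needed by the window certificates at the wild packets `p ∈ {3, 5}` — the tree held only
`d < 1 + v_p([K : ℚ_p])`, too weak whenever `p ∣ f`.  Both the subfield `K₀` and the sharp bound were absent
from the tree and from Mathlib.  Nothing here concerns [IUTchIII] Cor. 3.12; no abc claim.
[cite: SerreLocalFields1979, Ch. III §6 Prop. 13 and Remark; Ch. III §5 Thm. 3; Ch. I §4]
[cite: NeukirchANT1999, Ch. II (5.3), (7.12)]
-/

noncomputable section

open Metric Set IsLocalRing Module Polynomial
open scoped NormedField IntermediateField

namespace Literature.IUT.LogVolume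

open Literature.NumberTheory.GaloisRepresentations.Ultrametric (mem_maximalIdeal_iff_norm_lt_one
  finite_residueField)

variable (p : ℕ) [Fact p.Prime]
variable (K : Type*) [NontriviallyNormedField K] [instK : NormedAlgebra ℚ_[p] K]
  [IsUltrametricDist K] [ProperSpace K]

/-! ## §1 A primitive `(q − 1)`-th root of unity -/

/-- **`K` contains a primitive `(q − 1)`-th root of unity**, `q = p^f = #(𝒪_K/𝔪)` (Teichmüller
representatives: `#μ_{q−1}(K) = q − 1`, and `μ_{q−1}(K)` is cyclic). [cite: NeukirchANT1999, Ch. II (5.3)] -/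
theorem exists_isPrimitiveRoot_residueCard_sub_one :
    ∃ ζ : K, IsPrimitiveRoot ζ (p ^ residueDegree p K - 1) := by
  haveI : NeZero (p ^ residueDegree p K - 1) := ⟨residueCard_sub_one_ne_zero p K⟩
  exact card_rootsOfUnity_eq_iff_exists_isPrimitiveRoot.mp (card_rootsOfUnity_residueCard_sub_one p K)

/-! ## §2 Roots of unity of order prime to `p` are separated modulo `𝔪` -/

omit instK [IsUltrametricDist K] [ProperSpace K] in
/-- A root of unity has norm `1` (private helper). [folklore] -/
private theorem rootOfUnity_norm_eq_one {ζ : K} {n : ℕ} (hn : n ≠ 0) (hζ : ζ ^ n = 1) : ‖ζ‖ = 1 := by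
  have h : ‖ζ‖ ^ n = 1 := by rw [← norm_pow, hζ, norm_one]
  exact (pow_eq_one_iff_of_nonneg (norm_nonneg ζ) hn).mp h

omit [ProperSpace K] in
/-- **Distinct powers of a root of unity of order prime to `p` are incongruent modulo `𝔪`**: if `ζⁿ = 1`,
`p ∤ n` and `‖ζ^i − ζ^j‖ < 1` then `ζ^i = ζ^j` (`ω = ζ^j/ζ^i` is a root of unity of order prime to `p` in
`1 + 𝔪`, hence `ω = 1` by abc-iut-S1's `eq_one_of_pow_eq_one_of_not_dvd`). [cite: NeukirchANT1999, Ch. II (5.3)] -/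
theorem pow_eq_pow_of_norm_sub_lt_one {ζ : K} {n : ℕ} (hpn : ¬ p ∣ n) (hn : n ≠ 0) (hζ : ζ ^ n = 1)
    {i j : ℕ} (h : ‖ζ ^ i - ζ ^ j‖ < 1) : ζ ^ i = ζ ^ j := by
  have hζ1 : ‖ζ‖ = 1 := rootOfUnity_norm_eq_one K hn hζ
  have hζ0 : ζ ≠ 0 := norm_pos_iff.mp (by rw [hζ1]; exact one_pos)
  have hi0 : ζ ^ i ≠ 0 := pow_ne_zero _ hζ0
  have hω : (ζ ^ j * (ζ ^ i)⁻¹) ^ n = 1 := by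
    rw [mul_pow, inv_pow, ← pow_mul, ← pow_mul, mul_comm j n, mul_comm i n, pow_mul, pow_mul, hζ,
      one_pow, one_pow, inv_one, mul_one]
  have h1 : ‖1 - ζ ^ j * (ζ ^ i)⁻¹‖ < 1 := by
    have heq : (ζ ^ i - ζ ^ j) * (ζ ^ i)⁻¹ = 1 - ζ ^ j * (ζ ^ i)⁻¹ := by
      rw [sub_mul, mul_inv_cancel₀ hi0]
    rw [← heq, norm_mul, norm_inv, norm_pow, hζ1, one_pow, inv_one, mul_one]
    exact h
  have hω1 := eq_one_of_pow_eq_one_of_not_dvd p K hpn hω h1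
  calc ζ ^ i = ζ ^ j * (ζ ^ i)⁻¹ * ζ ^ i := by rw [hω1, one_mul]
    _ = ζ ^ j := by rw [mul_assoc, inv_mul_cancel₀ hi0, mul_one]

/-- **`n ≤ q − 1` if `K` contains a primitive `n`-th root of unity `ζ` with `p ∤ n`**: the residues of
`1, ζ, …, ζ^{n−1}` are `n` distinct nonzero elements of `𝒪_K/𝔪` (reduction is injective on roots of unity of
order prime to `p`). [cite: NeukirchANT1999, Ch. II (5.3)] [cite: SerreLocalFields1979, Ch. I §4] -/
theorem le_residueCard_sub_one_of_isPrimitiveRoot {ζ : K} {n : ℕ} (hpn : ¬ p ∣ n) (hn : n ≠ 0)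
    (hζ : IsPrimitiveRoot ζ n) : n ≤ p ^ residueDegree p K - 1 := by
  classical
  haveI : Finite (ResidueField (Valued.integer K)) := finite_residueField
  have hζ1 : ‖ζ‖ = 1 := rootOfUnity_norm_eq_one K hn hζ.pow_eq_one
  have hpow : ∀ i : ℕ, ‖ζ ^ i‖ = 1 := fun i ↦ by rw [norm_pow, hζ1, one_pow]
  let U : ℕ → Valued.integer K := fun i ↦ ⟨ζ ^ i, Valued.integer.mem_iff.mpr (hpow i).le⟩
  have hU0 : ∀ i, residue (Valued.integer K) (U i) ≠ 0 := fun i ↦ by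
    rw [Ne, residue_eq_zero_iff, mem_maximalIdeal_iff_norm_lt_one, not_lt]
    exact (hpow i).ge
  let g : Fin n → (ResidueField (Valued.integer K))ˣ := fun i ↦ Units.mk0 _ (hU0 i)
  have hg : Function.Injective g := by
    intro i j hij
    have h := congrArg (fun u : (ResidueField (Valued.integer K))ˣ ↦ (u : ResidueField (Valued.integer K)))
      hij
    simp only [g, Units.val_mk0] at h
    rw [← sub_eq_zero, ← map_sub, residue_eq_zero_iff, mem_maximalIdeal_iff_norm_lt_one] at h
    have h' : ‖ζ ^ (i : ℕ) - ζ ^ (j : ℕ)‖ < 1 := h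
    exact Fin.ext (hζ.pow_inj i.2 j.2 (pow_eq_pow_of_norm_sub_lt_one p K hpn hn hζ.pow_eq_one h'))
  calc n = Nat.card (Fin n) := by simp
    _ ≤ Nat.card (ResidueField (Valued.integer K))ˣ := Nat.card_le_card_of_injective g hg
    _ = p ^ residueDegree p K - 1 := by rw [Nat.card_units, card_residueField p K]

/-! ## §3 `ℚ_p(ζ)`, `ζ` a root of unity of order prime to `p`, is absolutely unramified -/

/-- **`K = ℚ_p(ζ)` with `ζⁿ = 1`, `p ∤ n` ⇒ `𝔇(𝒪_K/ℤ_p) = (1)`.**  For `x = ζ ∈ 𝒪_K` and `g` its minimal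
polynomial over `ℤ_p`, Mathlib's `aeval_derivative_mem_differentIdeal` gives `g′(ζ) ∈ 𝔇`; since `g ∣ Xⁿ − 1`
in `ℤ_p[X]` (`ℤ_p` integrally closed), `g′(ζ)·h(ζ) = n·ζ^{n−1}` is a unit of `𝒪_K` (`p ∤ n`), so `𝔇 ∋` a
unit. [cite: SerreLocalFields1979, Ch. III §6 Cor. 2 of Prop. 11; Ch. IV §4] [cite: NeukirchANT1999, Ch. II (7.12)] -/
theorem different_eq_top_of_adjoin_eq_top_of_pow_eq_one {ζ : K} {n : ℕ} (hpn : ¬ p ∣ n) (hn : n ≠ 0)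
    (hζ : ζ ^ n = 1) (hgen : Algebra.adjoin ℚ_[p] {ζ} = ⊤) : different p K = ⊤ := by
  have hζ1 : ‖ζ‖ = 1 := rootOfUnity_norm_eq_one K hn hζ
  set x : Valued.integer K := ⟨ζ, Valued.integer.mem_iff.mpr hζ1.le⟩ with hxdef
  have hxK : ((x : Valued.integer K) : K) = ζ := rfl
  haveI := finiteDimensional p K
  haveI : Algebra.IsAlgebraic ℚ_[p] K := Algebra.IsAlgebraic.of_finite ℚ_[p] K
  haveI : Algebra.IsSeparable ℚ_[p] K := inferInstance
  -- (1) `g′(x) ∈ 𝔇`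
  have hmem : aeval x (derivative (minpoly ℤ_[p] x)) ∈ different p K := by
    rw [different_eq]
    refine aeval_derivative_mem_differentIdeal ℤ_[p] ℚ_[p] K x ?_
    exact hgen
  -- (2) `g ∣ Xⁿ − 1`
  have hint : IsIntegral ℤ_[p] x := (isIntegral_integer p K).isIntegral x
  have hxn : x ^ n = 1 := Subtype.ext (by rw [SubmonoidClass.coe_pow, hxK, hζ, OneMemClass.coe_one])
  have hdvd : minpoly ℤ_[p] x ∣ X ^ n - 1 :=
    minpoly.isIntegrallyClosed_dvd hint (by rw [map_sub, map_pow, aeval_X, map_one, hxn, sub_self])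
  obtain ⟨h, hh⟩ := hdvd
  -- (3) `g′(x)·h(x) = n·x^{n−1}`
  have hder : aeval x (derivative (minpoly ℤ_[p] x)) * aeval x h =
      (n : Valued.integer K) * x ^ (n - 1) := by
    have e1 : derivative (X ^ n - 1 : ℤ_[p][X]) =
        derivative (minpoly ℤ_[p] x) * h + minpoly ℤ_[p] x * derivative h := by
      rw [hh, derivative_mul]
    have e2 := congrArg (aeval x) e1
    rw [derivative_sub, derivative_one, sub_zero, derivative_X_pow, map_mul, map_add, map_mul, map_mul,
      minpoly.aeval, zero_mul, add_zero, aeval_C, map_pow, aeval_X, map_natCast] at e2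
    exact e2.symm
  -- (4) `n·x^{n−1}` is a unit, hence so is `g′(x)`
  have hn1 : ‖(n : K)‖ = 1 := by
    rw [norm_natCast_eq_padicNorm p K n, Padic.norm_natCast_eq_one_iff]
    exact (Nat.Prime.coprime_iff_not_dvd Fact.out).mpr hpn
  have hunit_n : IsUnit (n : Valued.integer K) := by
    rw [Valued.integer.isUnit_iff_norm_eq_one]
    change ‖((n : Valued.integer K) : K)‖ = 1
    rw [SubringClass.coe_natCast]
    exact hn1
  have hunit_x : IsUnit x := by
    rw [Valued.integer.isUnit_iff_norm_eq_one]
    exact hζ1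
  have hunit : IsUnit (aeval x (derivative (minpoly ℤ_[p] x))) :=
    isUnit_of_mul_isUnit_left (by rw [hder]; exact hunit_n.mul (hunit_x.pow _))
  exact Ideal.eq_top_of_isUnit_mem _ hmem hunit

/-- `𝔇 = (1) ⇒ d = 0`. [cite: SerreLocalFields1979, Ch. III §6 Prop. 13] -/
theorem differentOrd_eq_zero_of_different_eq_top (h : different p K = ⊤) : differentOrd p K = 0 := by
  have h1 : different p K = Ideal.span {1} := by rw [h, Ideal.span_singleton_one]
  rw [differentOrd_eq_of_span p K h1, OneMemClass.coe_one, norm_one, Real.logb_one, neg_zero]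

/-- `d = 0 ⇒ e = 1` (if `p ∣ e` then `d ≥ 1`; if `p ∤ e` then `d = (e − 1)/e`).
[cite: SerreLocalFields1979, Ch. III §6 Prop. 13] -/
theorem absRamificationIdx_eq_one_of_differentOrd_eq_zero (h : differentOrd p K = 0) :
    absRamificationIdx p K = 1 := by
  have hnd : ¬ p ∣ absRamificationIdx p K := fun hd ↦ by
    have h1 := one_le_differentOrd_of_dvd p K hd
    rw [h] at h1
    exact absurd h1 (by norm_num)
  have he := differentOrd_eq_of_not_dvd p K hnd
  have hpos : (0 : ℝ) < absRamificationIdx p K := by exact_mod_cast absRamificationIdx_pos p K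
  rw [h, eq_comm, div_eq_zero_iff, or_iff_left hpos.ne', sub_eq_zero] at he
  exact_mod_cast he

/-- **`K = ℚ_p(ζ)`, `ζⁿ = 1`, `p ∤ n` ⇒ `e(K/ℚ_p) = 1`** (absolutely unramified).
[cite: NeukirchANT1999, Ch. II (7.12)] [cite: SerreLocalFields1979, Ch. IV §4 Prop. 16] -/
theorem absRamificationIdx_eq_one_of_adjoin_eq_top_of_pow_eq_one {ζ : K} {n : ℕ} (hpn : ¬ p ∣ n)
    (hn : n ≠ 0) (hζ : ζ ^ n = 1) (hgen : Algebra.adjoin ℚ_[p] {ζ} = ⊤) : absRamificationIdx p K = 1 :=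
  absRamificationIdx_eq_one_of_differentOrd_eq_zero p K (differentOrd_eq_zero_of_different_eq_top p K
    (different_eq_top_of_adjoin_eq_top_of_pow_eq_one p K hpn hn hζ hgen))

/-! ## §4 The maximal unramified subfield `K₀ = ℚ_p(ζ_{q−1})` -/

/-- **The maximal unramified subextension.**  There is an intermediate field `ℚ_p ⊆ K₀ ⊆ K` — namely
`K₀ = ℚ_p(ζ)` for a primitive `(q − 1)`-th root of unity `ζ ∈ K`, `q = p^f` — which is absolutely unramified
(`e(K₀) = 1`, `d(K₀) = 0`), has the SAME residue degree as `K` (`f(K₀) = f(K)`: `K₀ ∋ ζ` forces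
`q − 1 ≤ p^{f(K₀)} − 1`, and `f(K₀) ∣ f(K)`), and over which `K` is totally ramified of degree
`[K : K₀] = e(K)`; moreover `[K₀ : ℚ_p] = f(K)`.  (The `ProperSpace` structure of `K₀` — a finite-dimensional
`ℚ_p`-space — is part of the witness.) [cite: SerreLocalFields1979, Ch. III §5 Thm. 3 and Cor.; Ch. I §4]
[cite: NeukirchANT1999, Ch. II (7.12)] -/
theorem exists_maximalUnramified_intermediateField :
    ∃ (K₀ : IntermediateField ℚ_[p] K) (_ : ProperSpace K₀),
      absRamificationIdx p K₀ = 1 ∧ differentOrd p K₀ = 0 ∧ residueDegree p K₀ = residueDegree p K ∧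
        Module.finrank K₀ K = absRamificationIdx p K ∧ Module.finrank ℚ_[p] K₀ = residueDegree p K := by
  obtain ⟨ζ, hζ⟩ := exists_isPrimitiveRoot_residueCard_sub_one p K
  have hN0 : p ^ residueDegree p K - 1 ≠ 0 := residueCard_sub_one_ne_zero p K
  have hpN : ¬ p ∣ p ^ residueDegree p K - 1 := not_dvd_residueCard_sub_one p K
  haveI := finiteDimensional p K
  have hint : IsIntegral ℚ_[p] ζ := IsIntegral.of_finite ℚ_[p] ζ
  haveI hK₀ : ProperSpace (ℚ_[p]⟮ζ⟯ : IntermediateField ℚ_[p] K) := FiniteDimensional.proper ℚ_[p] _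
  letI : NormedAlgebra (ℚ_[p]⟮ζ⟯ : IntermediateField ℚ_[p] K) K :=
    { (inferInstance : Algebra (ℚ_[p]⟮ζ⟯ : IntermediateField ℚ_[p] K) K) with
      norm_smul_le := fun c y ↦ by rw [Algebra.smul_def]; exact norm_mul_le _ _ }
  -- the generator inside `K₀`
  have hζ₀K : ((IntermediateField.AdjoinSimple.gen ℚ_[p] ζ : ℚ_[p]⟮ζ⟯) : K) = ζ :=
    IntermediateField.AdjoinSimple.coe_gen ℚ_[p] ζ
  have hζ₀ : IsPrimitiveRoot (IntermediateField.AdjoinSimple.gen ℚ_[p] ζ) (p ^ residueDegree p K - 1) :=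
    IsPrimitiveRoot.coe_submonoidClass_iff.mp (by rw [hζ₀K]; exact hζ)
  have hgen : Algebra.adjoin ℚ_[p] {IntermediateField.AdjoinSimple.gen ℚ_[p] ζ} = ⊤ := by
    have h := (IntermediateField.adjoin.powerBasis hint).adjoin_gen_eq_top
    rwa [IntermediateField.adjoin.powerBasis_gen] at h
  -- `e₀ = 1`, `d₀ = 0`
  have hdiff : different p (ℚ_[p]⟮ζ⟯ : IntermediateField ℚ_[p] K) = ⊤ :=
    different_eq_top_of_adjoin_eq_top_of_pow_eq_one p _ hpN hN0 hζ₀.pow_eq_one hgen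
  have hd₀ := differentOrd_eq_zero_of_different_eq_top p _ hdiff
  have he₀ := absRamificationIdx_eq_one_of_differentOrd_eq_zero p _ hd₀
  -- `f₀ = f`
  have hf₀ : residueDegree p (ℚ_[p]⟮ζ⟯ : IntermediateField ℚ_[p] K) = residueDegree p K := by
    have hdvd := residueDegree_dvd p (ℚ_[p]⟮ζ⟯ : IntermediateField ℚ_[p] K) K
    have hle := le_residueCard_sub_one_of_isPrimitiveRoot p (ℚ_[p]⟮ζ⟯ : IntermediateField ℚ_[p] K)
      hpN hN0 hζ₀
    have h1 : 1 ≤ p ^ residueDegree p K := Nat.one_le_pow _ _ (Fact.out : p.Prime).pos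
    have h2 : 1 ≤ p ^ residueDegree p (ℚ_[p]⟮ζ⟯ : IntermediateField ℚ_[p] K) :=
      Nat.one_le_pow _ _ (Fact.out : p.Prime).pos
    have hle' : p ^ residueDegree p K ≤ p ^ residueDegree p (ℚ_[p]⟮ζ⟯ : IntermediateField ℚ_[p] K) := by
      omega
    have hff := (Nat.pow_le_pow_iff_right (Fact.out : p.Prime).one_lt).mp hle'
    exact le_antisymm (Nat.le_of_dvd (residueDegree_pos p K) hdvd) hff
  refine ⟨ℚ_[p]⟮ζ⟯, hK₀, he₀, hd₀, hf₀, ?_, ?_⟩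
  · -- `[K : K₀] = e'·(f/f₀) = e`
    have h := relRamificationIdx_mul_residueDegree_div p (ℚ_[p]⟮ζ⟯ : IntermediateField ℚ_[p] K) K
    rw [hf₀, Nat.div_self (residueDegree_pos p K), mul_one, relRamificationIdx, he₀, Nat.div_one] at h
    exact h.symm
  · -- `[K₀ : ℚ_p] = e₀ f₀ = f`
    have h := absRamificationIdx_mul_residueDegree p (ℚ_[p]⟮ζ⟯ : IntermediateField ℚ_[p] K)
    rw [he₀, one_mul, hf₀] at h
    exact h.symm

/-! ## §5 The sharp bound on the different -/

/-- **`d < 1 + v_p(e)`** — Lenstra's bound (abc-iut-L5-t15's `differentOrd_lt`: `d_K < d₀ + 1/e₀ + v_p([K : k₀])`)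
over the maximal unramified subfield `K₀` (`d₀ = 0`, `e₀ = 1`, `[K : K₀] = e`).
[cite: SerreLocalFields1979, Ch. III §6 Prop. 13 and Remark] -/
theorem differentOrd_lt_one_add_padicValNat_absRamificationIdx :
    differentOrd p K < 1 + padicValNat p (absRamificationIdx p K) := by
  obtain ⟨K₀, hK₀, he₀, hd₀, -, hdeg, -⟩ := exists_maximalUnramified_intermediateField p K
  letI : NormedAlgebra K₀ K :=
    { (inferInstance : Algebra K₀ K) with
      norm_smul_le := fun c y ↦ by rw [Algebra.smul_def]; exact norm_mul_le _ _ }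
  have h := differentOrd_lt p K₀ K
  rw [hd₀, he₀, hdeg, Nat.cast_one, div_one, zero_add] at h
  exact h

/-- **The sharp (Hensel–Ore) bound `d ≤ 1 − 1/e + v_p(e)`** for the order of the different of ANY finite
extension `K/ℚ_p`: `d = δ/e` with `δ ∈ ℕ` and `δ/e < 1 + v_p(e)` give `δ ≤ e − 1 + e·v_p(e)`.  Equality holds
e.g. for `ℚ_p(ζ_p, p^{1/p})` (`EisensteinRadicalDifferent.lean`); the tame case `p ∤ e` is `d = 1 − 1/e`
(`differentOrd_eq_of_not_dvd`). [cite: SerreLocalFields1979, Ch. III §6 Prop. 13 and Remark] -/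
theorem differentOrd_le_one_sub_inv_add_padicValNat :
    differentOrd p K ≤ 1 - 1 / (absRamificationIdx p K : ℝ) + padicValNat p (absRamificationIdx p K) := by
  obtain ⟨δ, -, hd⟩ := exists_different_eq_maximalIdeal_pow p K
  have hlt := differentOrd_lt_one_add_padicValNat_absRamificationIdx p K
  have he : (0 : ℝ) < absRamificationIdx p K := by exact_mod_cast absRamificationIdx_pos p K
  rw [hd] at hlt ⊢
  rw [div_lt_iff₀ he] at hlt
  -- `δ < (1 + v)·e` in `ℕ`, hence `δ + 1 ≤ (1 + v)·e`
  have h2 : δ < (1 + padicValNat p (absRamificationIdx p K)) * absRamificationIdx p K := by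
    exact_mod_cast hlt
  have h3 : (δ : ℝ) + 1 ≤ (1 + padicValNat p (absRamificationIdx p K)) * absRamificationIdx p K := by
    exact_mod_cast h2
  rw [div_le_iff₀ he]
  have h4 : (1 - 1 / (absRamificationIdx p K : ℝ) + padicValNat p (absRamificationIdx p K)) *
      absRamificationIdx p K =
        (1 + padicValNat p (absRamificationIdx p K)) * absRamificationIdx p K - 1 := by
    field_simp
    ring
  rw [h4]
  linarith

/-- **Integer form: `e·d ≤ e − 1 + e·v_p(e)`** (`e·d = δ = v_K(𝔇)`).
[cite: SerreLocalFields1979, Ch. III §6 Prop. 13 and Remark] -/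
theorem natCast_mul_differentOrd_le :
    (absRamificationIdx p K : ℝ) * differentOrd p K ≤
      (absRamificationIdx p K : ℝ) - 1 + absRamificationIdx p K * padicValNat p (absRamificationIdx p K) := by
  have h := differentOrd_le_one_sub_inv_add_padicValNat p K
  have he : (0 : ℝ) < absRamificationIdx p K := by exact_mod_cast absRamificationIdx_pos p K
  have h2 := mul_le_mul_of_nonneg_left h he.le
  have h3 : (absRamificationIdx p K : ℝ) * (1 - 1 / (absRamificationIdx p K : ℝ) +
      padicValNat p (absRamificationIdx p K)) =
        (absRamificationIdx p K : ℝ) - 1 + absRamificationIdx p K * padicValNat p (absRamificationIdx p K) := by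
    field_simp
  rw [h3] at h2
  exact h2

/-- **`𝔇 = 𝔪^δ ⇒ δ ≤ e − 1 + e·v_p(e)`** (Ore's bound `v_K(𝔇_{K/ℚ_p}) ≤ e − 1 + v_K(e)`), for every exponent
`δ` with `𝔇(𝒪_K/ℤ_p) = 𝔪^δ`. [cite: SerreLocalFields1979, Ch. III §6 Prop. 13 and Remark] -/
theorem different_exponent_le {δ : ℕ} (hδ : different p K = maximalIdeal (Valued.integer K) ^ δ) :
    δ ≤ absRamificationIdx p K - 1 + absRamificationIdx p K * padicValNat p (absRamificationIdx p K) := by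
  obtain ⟨δ', hδ', hd⟩ := exists_different_eq_maximalIdeal_pow p K
  have hδδ : δ = δ' := by
    have hinj := (Ideal.pow_right_strictAnti (maximalIdeal (Valued.integer K))
      (IsDiscreteValuationRing.not_a_field _) (IsLocalRing.maximalIdeal.isMaximal _).ne_top).injective
    exact hinj (hδ.symm.trans hδ')
  subst hδδ
  have he := absRamificationIdx_pos p K
  have heR : (0 : ℝ) < absRamificationIdx p K := by exact_mod_cast he
  have h := natCast_mul_differentOrd_le p K
  rw [hd, mul_div_cancel₀ _ heR.ne'] at h
  have h' : (δ : ℝ) ≤ ((absRamificationIdx p K - 1 + absRamificationIdx p K *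
      padicValNat p (absRamificationIdx p K) : ℕ) : ℝ) := by
    push_cast [Nat.cast_sub he]
    linarith
  exact_mod_cast h'

end Literature.IUT.LogVolume

end
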